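import Summits.QuantumFields.YangMills.Theorems.LuscherReductionTwistedTraceScalingBOColourAssembly
import Summits.QuantumFields.YangMills.Theorems.LuscherReductionTwistedTraceScalingBOKernel
import Summits.QuantumFields.YangMills.Theorems.LuscherReductionTwistedTraceScalingBOSlowSchur
import HarnessLib

/-!
# (C4)-CORE data: the transfer of a BO function in Faddeev–Popov form, and the slow factors `P = ∫φρ̃`, `P_a = ∫|φ|ρ̃` (measurable, bounded, Schur)
# (lane A of S-BASE, crux `TwistedTraceScaling` stmt-QuantumFields-20203, C4-CORE, the (OD) pen; COARSE-DESIGN §27.7 (C3)/(C4))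

The two inputs that turn `…BODefectCoreSq.defect_core_sq_integral_le` (abstract `K`, `P`, `P_a`) into a statement about the record data:
* §1 ★ `transferApply_boFun_eq_fp` — (C3) in the form the core lemma wants: for every `U`,
  `K̃(φ⊗Ω)(U) = ∫_V K̃(U,V)(φ⊗Ω)(V) dV = Z⁻¹·∫_u φ(u)·(∫_c fpFibreTransfer β Ω W (c⁻¹Uc) u dc) du`
  (`transferApply_boFun_eq` + `fibreTransfer_fp`; `W` any bounded measurable weight with constant colour mass `Z > 0`);
* §2 the slow factors against the normalised colour-averaged one-site kernel `ρ̃(u',u) = K̃₁^{(B)}(u',u)/K₁^{(B)}(1,1)`: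
  `P(u') = ∫ φρ̃(u',·)`, `P_a(u') = ∫ |φ|ρ̃(u',·)` are measurable and bounded, `|P| ≤ P_a`, `0 ≤ P_a`, and ★ `sq_integral_slowPa_le`:
  `∫ P_a² ≤ (linkCE B/K₁(1,1))²·∫ φ²` (`…BOSlowSchur.sq_integral_avgKernel_one_le` with `h = |φ|`).
HONEST FRAMING: bookkeeping for the (C4)-core `L²` estimate; (C5), the final `b`, (B-ST), C4-CORE OPEN; stub of a child of the CONDITIONAL route R2b1; not a gap, not Clay.
-/

set_option autoImplicit false

noncomputable section

open MeasureTheory Filter Topology Real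
open scoped BigOperators
open Literature.MathematicalPhysics.QuantumFieldTheory
open Literature.MathematicalPhysics.QuantumLattice

namespace Summit.QuantumFields.YangMills.Theorems.FemtoTransferGap.TwoLattice.ConstTube

open Summit.QuantumFields.YangMills.Theorems.FemtoTransferGap
open Summit.QuantumFields.YangMills.Theorems.FemtoTransferGap.TwoLattice
open Summit.QuantumFields.YangMills.Theorems.FemtoTransferGap.TwoLattice.Avg
open Summit.QuantumFields.YangMills.Theorems.FemtoTransferGap.TwoLattice.Stiff (LinkSpace)

variable {L : ℕ} [NeZero L]

/-! ## §1 ★ The transfer of a BO function in Faddeev–Popov form -/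

/-- ★ **(C3) for the core lemma**: `∫_V K̃(U,V)·boFun φ Ω(V) dV = Z⁻¹·∫_u φ(u)·(∫_c fpFibreTransfer β Ω W (c⁻¹Uc) u dc) du` for bounded measurable `φ, Ω`, a bounded
measurable weight `W` whose colour mass `∫_c W(c·g) dc = Z` is constant and positive. [cite: Luscher1983, §3] -/
theorem transferApply_boFun_eq_fp (β : ℝ) {φ : GaugeConfig 3 1 SU2 → ℝ} (hφ : Measurable φ) {Cφ : ℝ} (hCφ : ∀ u, |φ u| ≤ Cφ) {Ω : LinkSpace L → ℝ}
    (hΩ : Measurable Ω) {CΩ : ℝ} (hCΩ : ∀ x, |Ω x| ≤ CΩ) {W : (Site 3 L → SU2) → ℝ} (hW : Measurable W) {CW : ℝ} (hCW : ∀ g, |W g| ≤ CW) {Z : ℝ}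
    (hZ : ∀ g : Site 3 L → SU2, ∫ c, W (fun x => c * g x) ∂haarProbability SU2 = Z) (hZ0 : 0 < Z) (U : GaugeConfig 3 L SU2) :
    ∫ V, avgKernel β U V * boFun L φ Ω V ∂configMeasure SU2 L =
      Z⁻¹ * ∫ u, φ u * (∫ c, fpFibreTransfer L β Ω W (gaugeTransform (fun _ : Site 3 L => c⁻¹) U) u ∂haarProbability SU2) ∂configMeasure SU2 1 := by
  rw [transferApply_boFun_eq β hφ hCφ hΩ hCΩ U, ← integral_const_mul]
  refine integral_congr_ae (ae_of_all _ fun u => ?_)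
  dsimp only
  have h := (fibreTransfer_fp (L := L) β hΩ hCΩ hW hCW hZ U u).2
  have e : ∫ v, avgKernel β U (orthoTube L u v) * Ω (linkEmbed L v) ∂orthoTransverse L =
      Z⁻¹ * ∫ c, fpFibreTransfer L β Ω W (gaugeTransform (fun _ : Site 3 L => c⁻¹) U) u ∂haarProbability SU2 := by
    rw [← h, ← mul_assoc, inv_mul_cancel₀ hZ0.ne', one_mul]
  rw [e]; ring

/-! ## §2 The slow factors `P`, `P_a` -/

/-- Joint measurability of the normalised colour-averaged one-site kernel times a measurable amplitude. [folklore] -/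
theorem measurable_slowKernel_mul (B K : ℝ) {h : GaugeConfig 3 1 SU2 → ℝ} (hh : Measurable h) :
    Measurable (Function.uncurry fun (u' u : GaugeConfig 3 1 SU2) => h u * (avgKernel B u' u / K)) :=
  (hh.comp measurable_snd).mul ((measurable_avgKernel (L := 1) B).div_const K)

/-- `u' ↦ ∫ h(u)·ρ̃(u',u) du` is measurable. [folklore] -/
theorem measurable_slowP (B K : ℝ) {h : GaugeConfig 3 1 SU2 → ℝ} (hh : Measurable h) :
    Measurable fun u' : GaugeConfig 3 1 SU2 => ∫ u, h u * (avgKernel B u' u / K) ∂configMeasure SU2 1 :=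
  ((measurable_slowKernel_mul B K hh).stronglyMeasurable.integral_prod_right' (ν := configMeasure SU2 1)).measurable

/-- `|∫ h·ρ̃(u',·)| ≤ C_h·M₁/K` for `|h| ≤ C_h`, `K̃₁ ≤ M₁`, `K > 0` (the one-site a-priori measure is a probability measure). [folklore] -/
theorem abs_slowP_le {B K : ℝ} (hK : 0 < K) {h : GaugeConfig 3 1 SU2 → ℝ} {Ch : ℝ} (hCh : ∀ u, |h u| ≤ Ch) {M : ℝ} (hM : ∀ u' u : GaugeConfig 3 1 SU2, avgKernel B u' u ≤ M)
    (u' : GaugeConfig 3 1 SU2) : |∫ u, h u * (avgKernel B u' u / K) ∂configMeasure SU2 1| ≤ Ch * (M / K) := by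
  have hCh0 : 0 ≤ Ch := (abs_nonneg _).trans (hCh 1)
  calc |∫ u, h u * (avgKernel B u' u / K) ∂configMeasure SU2 1| ≤ ∫ u, |h u * (avgKernel B u' u / K)| ∂configMeasure SU2 1 := abs_integral_le_integral_abs
    _ ≤ ∫ _u, Ch * (M / K) ∂configMeasure SU2 1 := by
        refine integral_mono_of_nonneg (ae_of_all _ fun _ => abs_nonneg _) (integrable_const _) (ae_of_all _ fun u => ?_)
        show |h u * (avgKernel B u' u / K)| ≤ Ch * (M / K)
        rw [abs_mul, abs_of_pos (div_pos (avgKernel_pos B _ _) hK)]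
        exact mul_le_mul (hCh u) (div_le_div_of_nonneg_right (hM _ _) hK.le) (div_pos (avgKernel_pos B _ _) hK).le hCh0
    _ = Ch * (M / K) := by rw [integral_const, smul_eq_mul, probReal_univ, one_mul]

/-- `|∫ φρ̃| ≤ ∫ |φ|ρ̃` (`ρ̃ > 0`). [folklore] -/
theorem abs_slowP_le_slowPa {B K : ℝ} (hK : 0 < K) {φ : GaugeConfig 3 1 SU2 → ℝ} (u' : GaugeConfig 3 1 SU2) :
    |∫ u, φ u * (avgKernel B u' u / K) ∂configMeasure SU2 1| ≤ ∫ u, |φ u| * (avgKernel B u' u / K) ∂configMeasure SU2 1 := by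
  calc |∫ u, φ u * (avgKernel B u' u / K) ∂configMeasure SU2 1| ≤ ∫ u, |φ u * (avgKernel B u' u / K)| ∂configMeasure SU2 1 := abs_integral_le_integral_abs
    _ = ∫ u, |φ u| * (avgKernel B u' u / K) ∂configMeasure SU2 1 :=
        integral_congr_ae (ae_of_all _ fun u => by dsimp only; rw [abs_mul, abs_of_pos (div_pos (avgKernel_pos B _ _) hK)])

/-- `0 ≤ ∫ |φ|ρ̃`. [folklore] -/
theorem slowPa_nonneg {B K : ℝ} (hK : 0 < K) (φ : GaugeConfig 3 1 SU2 → ℝ) (u' : GaugeConfig 3 1 SU2) :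
    0 ≤ ∫ u, |φ u| * (avgKernel B u' u / K) ∂configMeasure SU2 1 :=
  integral_nonneg fun _ => mul_nonneg (abs_nonneg _) (div_pos (avgKernel_pos B _ _) hK).le

/-- ★ **Schur for the slow factor**: `∫_{u'} (∫_u |φ(u)|·K̃₁^{(B)}(u',u)/K du)² du' ≤ (linkCE B/K)²·∫ φ²` for bounded measurable `φ`, `B ≥ 0`, `K > 0`.
[cite: Helffer2013, Lemma 7.1] -/
theorem sq_integral_slowPa_le {B K : ℝ} (hB : 0 ≤ B) (hK : 0 < K) {φ : GaugeConfig 3 1 SU2 → ℝ} (hφ : Measurable φ) {Cφ : ℝ} (hCφ : ∀ u, |φ u| ≤ Cφ) :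
    ∫ u', (∫ u, |φ u| * (avgKernel B u' u / K) ∂configMeasure SU2 1) ^ 2 ∂configMeasure SU2 1 ≤ (linkCE B / K) ^ 2 * ∫ u, φ u ^ 2 ∂configMeasure SU2 1 := by
  have h := sq_integral_avgKernel_one_le hB hφ.abs (Ch := Cφ) (fun u => by rw [abs_abs]; exact hCφ u)
  have e1 : ∀ u', ∫ u, |φ u| * (avgKernel B u' u / K) ∂configMeasure SU2 1 = (∫ u, avgKernel B u' u * |φ u| ∂configMeasure SU2 1) / K := fun u' => by
    rw [eq_div_iff hK.ne', ← integral_mul_const]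
    exact integral_congr_ae (ae_of_all _ fun _ => by dsimp only; field_simp)
  have e2 : ∫ u, |φ u| ^ 2 ∂configMeasure SU2 1 = ∫ u, φ u ^ 2 ∂configMeasure SU2 1 := integral_congr_ae (ae_of_all _ fun u => by dsimp only; rw [sq_abs])
  rw [e2] at h
  calc ∫ u', (∫ u, |φ u| * (avgKernel B u' u / K) ∂configMeasure SU2 1) ^ 2 ∂configMeasure SU2 1
      = ∫ u', (∫ u, avgKernel B u' u * |φ u| ∂configMeasure SU2 1) ^ 2 / K ^ 2 ∂configMeasure SU2 1 :=
        integral_congr_ae (ae_of_all _ fun u' => by dsimp only; rw [e1, div_pow])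
    _ = (∫ u', (∫ u, avgKernel B u' u * |φ u| ∂configMeasure SU2 1) ^ 2 ∂configMeasure SU2 1) / K ^ 2 := integral_div _ _
    _ ≤ (linkCE B ^ 2 * ∫ u, φ u ^ 2 ∂configMeasure SU2 1) / K ^ 2 := div_le_div_of_nonneg_right h (sq_nonneg _)
    _ = (linkCE B / K) ^ 2 * ∫ u, φ u ^ 2 ∂configMeasure SU2 1 := by rw [div_pow]; ring

end Summit.QuantumFields.YangMills.Theorems.FemtoTransferGap.TwoLattice.ConstTube

end
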